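import Literature.Computability.QuantumComplexity.ApproxBosonSamplingIdealSide
import Literature.Probability.Distributions.RoundedGaussian
import Literature.Computability.Complexity.CoinChunks
import HarnessLib

/-!
# The rounded Gaussian matrix: product law of the rounding, and domination by the coin sampler

Family `quantum-advantage`, the REAL side of the discharge of Aaronson–Arkhipov's Thm. 1.3
(`gpeSolvableInFBPPRel_NPRel_of_approxBosonSamplingOracle`) by the Gaussian-extension route: the
`|GPE|²` solver receives the `b`-bit rounding `X̃ = round_b X` (`roundDyadic`) of `X ∼ 𝒢^{n×n}`
(`gaussianMatrixMeasure`) and plants its rows among coin-sampled rows; the analysis is done in the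
IDEAL world where the planted rows are coin-sampled too (`PGParams.samplerFlat`,
`PseudoGaussianSamplerCoins.lean`). This file transports upper bounds on failure probabilities from
the ideal world to the real one:

* `roundBox b z` (the complex rounding box of a Gaussian integer `z`), `stdComplexGaussian_real_roundBox`
  (`= gaussBox b z.1 · gaussBox b z.2`), **`gaussianMatrixMeasure_real_roundEq`** —
  `Pr[round_b X = x̃] = ∏ᵢⱼ gaussBox (x̃ᵢⱼ.1) gaussBox (x̃ᵢⱼ.2)` (`Measure.pi_pi` twice);
* `entryOfCoins`, `rowsOfCoins` (the planted rows of the ideal world, from a coin segment of length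
  `n · n · 2 coinLen`) and **`card_rowsOfCoins_eq`** —
  `#{v | rowsOfCoins v = x̃} = 2^{…} ∏ᵢⱼ law (x̃ᵢⱼ.1) law (x̃ᵢⱼ.2)` (`card_samplerFlat_eq` coordinate by
  coordinate through the chunk bijections of `CoinChunks.lean`);
* **`sum_real_roundEvent_le`** — the transfer: for any event `E(x̃, r)` of the rounded input and the
  coins, if `gaussBox b j ≤ F · law j` on the range `|j| < T`, then
  `∑_r Pr_X[E(X̃, r)] ≤ 2^{|r|} Pr_X[X̃ out of range] + F^{2n²} · 2^{-Lₓ} · #{(rₓ, r) | E(rows(rₓ), r)}`.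

All proved.

## References

* S. Aaronson, A. Arkhipov, *The computational complexity of linear optics*, Theory of Computing 9
  (2013) 143–252, §5.2 (proof of Thm. 1.3; p. 195, the hiding procedure in `BPP`) and §2 (p. 161).
-/

noncomputable section

namespace Literature.Computability.QuantumComplexity

open MeasureTheory ProbabilityTheory Finset Literature.Computability.Cryptography
  Literature.Computability.Complexity Literature.Probability.Distributions
open scoped NNReal

variable {n : ℕ}

/-! ### The rounding boxes and their Gaussian mass -/

/-- The complex rounding box of the Gaussian integer `z` at precision `b`: `{w | round_b w = z}`.
[folklore] -/
def roundBox (b : ℕ) (z : ℤ × ℤ) : Set ℂ := {w | roundDyadic b w = z}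

/-- The real rounding box `{x | round(2ᵇ x) = j}` is measurable. [folklore] -/
theorem measurableSet_roundSet (b : ℕ) (j : ℤ) : MeasurableSet {x : ℝ | round ((2 : ℝ) ^ b * x) = j} :=
  measurableSet_round_eq b j

/-- The complex rounding box is the product of the two real boxes. [folklore] -/
theorem preimage_roundBox (b : ℕ) (z : ℤ × ℤ) :
    Complex.measurableEquivRealProd.symm ⁻¹' roundBox b z =
      {x : ℝ | round ((2 : ℝ) ^ b * x) = z.1} ×ˢ {x : ℝ | round ((2 : ℝ) ^ b * x) = z.2} := by
  ext p
  obtain ⟨z1, z2⟩ := z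
  simp [roundBox, roundDyadic, Complex.measurableEquivRealProd_symm_apply, Prod.ext_iff]

/-- The complex rounding box is measurable. [folklore] -/
theorem measurableSet_roundBox (b : ℕ) (z : ℤ × ℤ) : MeasurableSet (roundBox b z) := by
  have h : roundBox b z = Complex.measurableEquivRealProd ⁻¹'
      ({x : ℝ | round ((2 : ℝ) ^ b * x) = z.1} ×ˢ {x : ℝ | round ((2 : ℝ) ^ b * x) = z.2}) := by
    rw [← preimage_roundBox, ← Set.preimage_comp]
    simp
  rw [h]
  exact (MeasurableEquiv.measurable _) ((measurableSet_roundSet b z.1).prod (measurableSet_roundSet b z.2))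

/-- **The standard complex Gaussian mass of a rounding box**: `gaussBox b z.1 · gaussBox b z.2`.
[folklore] -/
theorem stdComplexGaussian_real_roundBox (b : ℕ) (z : ℤ × ℤ) :
    stdComplexGaussian.real (roundBox b z) = gaussBox b z.1 * gaussBox b z.2 := by
  rw [stdComplexGaussian, measureReal_def, MeasurableEquiv.map_apply, preimage_roundBox, Measure.prod_prod,
    ENNReal.toReal_mul]
  rfl

/-- **The law of the rounded Gaussian matrix**:
`Pr_{X ∼ 𝒢}[∀ i j, round_b X_{ij} = x̃_{ij}] = ∏ᵢ ∏ⱼ gaussBox (x̃ᵢⱼ.1) · gaussBox (x̃ᵢⱼ.2)`. [folklore] -/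
theorem gaussianMatrixMeasure_real_roundEq (b : ℕ) (x : Fin n → Fin n → ℤ × ℤ) :
    (gaussianMatrixMeasure n).real {X | ∀ i j, roundDyadic b (X i j) = x i j} =
      ∏ i, ∏ j, (gaussBox b (x i j).1 * gaussBox b (x i j).2) := by
  have hset : {X : Fin n → Fin n → ℂ | ∀ i j, roundDyadic b (X i j) = x i j} =
      Set.pi Set.univ fun i => Set.pi Set.univ fun j => roundBox b (x i j) := by
    ext X; simp [roundBox]
  rw [hset, gaussianMatrixMeasure, measureReal_def, Measure.pi_pi, ENNReal.toReal_prod]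
  refine Finset.prod_congr rfl fun i _ => ?_
  rw [Measure.pi_pi, ENNReal.toReal_prod]
  refine Finset.prod_congr rfl fun j _ => ?_
  exact stdComplexGaussian_real_roundBox b (x i j)

/-- The event `round_b X = x̃` is measurable. [folklore] -/
theorem measurableSet_roundEq (b : ℕ) (x : Fin n → Fin n → ℤ × ℤ) :
    MeasurableSet {X : Fin n → Fin n → ℂ | ∀ i j, roundDyadic b (X i j) = x i j} := by
  have hset : {X : Fin n → Fin n → ℂ | ∀ i j, roundDyadic b (X i j) = x i j} =
      Set.pi Set.univ fun i => Set.pi Set.univ fun j => roundBox b (x i j) := by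
    ext X; simp [roundBox]
  rw [hset]
  exact MeasurableSet.univ_pi fun i => MeasurableSet.univ_pi fun j => measurableSet_roundBox b (x i j)

/-! ### The planted rows of the ideal world, from coins -/

variable (P : PGParams)

/-- One entry from a coin block of length `2 · coinLen`: two sampler runs. [folklore] -/
def entryOfCoins (a : List Bool) : ℤ × ℤ :=
  (P.samplerFlat (a.take P.coinLen), P.samplerFlat ((a.drop P.coinLen).take P.coinLen))

/-- **The planted rows of the ideal world**: `n × n` entries from consecutive coin blocks. [folklore] -/
def rowsOfCoins (v : List.Vector Bool (n * (n * (2 * P.coinLen)))) (i j : Fin n) : ℤ × ℤ :=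
  entryOfCoins P (matChunk v i j).toList

/-- The entry decoding through the two half-blocks. [folklore] -/
theorem entryOfCoins_eq (a : List.Vector Bool (2 * P.coinLen)) :
    entryOfCoins P a.toList = (P.samplerFlat (chunkVec a 0).toList, P.samplerFlat (chunkVec a 1).toList) := by
  simp [entryOfCoins, chunkVec]

/-- **The number of coin blocks decoding to the entry `z`** is `law z.1 · law z.2 · 2^{2 coinLen}`.
[folklore] -/
theorem card_entryOfCoins_eq (z : ℤ × ℤ) :
    ((univ.filter fun a : List.Vector Bool (2 * P.coinLen) => entryOfCoins P a.toList = z).card : ℝ) =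
      P.law z.1 * P.law z.2 * 2 ^ (2 * P.coinLen) := by
  classical
  -- through the chunk bijection with `J = 2`
  have h1 : (univ.filter fun a : List.Vector Bool (2 * P.coinLen) => entryOfCoins P a.toList = z).card =
      (univ.filter fun f : Fin 2 → List.Vector Bool P.coinLen =>
        P.samplerFlat (f 0).toList = z.1 ∧ P.samplerFlat (f 1).toList = z.2).card := by
    rw [← card_filter_chunkVec]
    congr 1
    ext a
    simp only [mem_filter, mem_univ, true_and, entryOfCoins_eq, Prod.ext_iff]
  -- `Fin 2 → V ≃ V × V`
  have h2 : (univ.filter fun f : Fin 2 → List.Vector Bool P.coinLen =>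
        P.samplerFlat (f 0).toList = z.1 ∧ P.samplerFlat (f 1).toList = z.2).card =
      (univ.filter fun v : List.Vector Bool P.coinLen => P.samplerFlat v.toList = z.1).card *
        (univ.filter fun v : List.Vector Bool P.coinLen => P.samplerFlat v.toList = z.2).card := by
    rw [← Finset.card_product]
    refine card_bij (fun f _ => (f 0, f 1)) (fun f hf => ?_) (fun f _ g _ h => ?_) (fun q hq => ?_)
    · simp only [mem_filter, mem_univ, true_and] at hf
      simp [hf.1, hf.2]
    · simp only [Prod.mk.injEq] at h
      funext i
      fin_cases i
      · exact h.1
      · exact h.2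
    · refine ⟨fun i => if i = 0 then q.1 else q.2, ?_, by simp⟩
      simp only [mem_product, mem_filter, mem_univ, true_and] at hq ⊢
      simpa using hq
  rw [h1, h2, Nat.cast_mul, P.card_samplerFlat_eq, P.card_samplerFlat_eq]
  ring

/-- **The number of coin segments decoding to the rows `x̃`** is
`(∏ᵢⱼ law (x̃ᵢⱼ.1) · law (x̃ᵢⱼ.2)) · 2^{n·n·2 coinLen}`. [folklore] -/
theorem card_rowsOfCoins_eq (x : Fin n → Fin n → ℤ × ℤ) :
    ((univ.filter fun v : List.Vector Bool (n * (n * (2 * P.coinLen))) => rowsOfCoins P v = x).card : ℝ) =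
      (∏ i, ∏ j, (P.law (x i j).1 * P.law (x i j).2)) * 2 ^ (n * (n * (2 * P.coinLen))) := by
  classical
  -- through the array bijection
  have h1 : (univ.filter fun v : List.Vector Bool (n * (n * (2 * P.coinLen))) => rowsOfCoins P v = x).card =
      (univ.filter fun f : Fin n → Fin n → List.Vector Bool (2 * P.coinLen) =>
        ∀ i j, entryOfCoins P (f i j).toList = x i j).card := by
    refine card_bij (fun v _ => matChunk v) (fun v hv => ?_) (fun v _ w _ h => (matChunk_bijective _ _ _).1 h)
      fun f hf => ?_
    · simp only [mem_filter, mem_univ, true_and] at hv ⊢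
      intro i j
      have := congrFun (congrFun hv i) j
      exact this
    · obtain ⟨v, rfl⟩ := (matChunk_bijective _ _ _).2 f
      refine ⟨v, ?_, rfl⟩
      simp only [mem_filter, mem_univ, true_and] at hf ⊢
      funext i j
      exact hf i j
  -- the set of such arrays is a product set
  have h2 : (univ.filter fun f : Fin n → Fin n → List.Vector Bool (2 * P.coinLen) =>
        ∀ i j, entryOfCoins P (f i j).toList = x i j) =
      Fintype.piFinset fun i => Fintype.piFinset fun j =>
        univ.filter fun a : List.Vector Bool (2 * P.coinLen) => entryOfCoins P a.toList = x i j := by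
    ext f
    simp [Fintype.mem_piFinset]
  rw [h1, h2, Fintype.card_piFinset]
  simp_rw [Fintype.card_piFinset]
  push_cast
  simp_rw [card_entryOfCoins_eq]
  have hrow : ∀ i : Fin n, ∏ j : Fin n, (P.law (x i j).1 * P.law (x i j).2 * (2 : ℝ) ^ (2 * P.coinLen)) =
      (∏ j, P.law (x i j).1 * P.law (x i j).2) * ((2 : ℝ) ^ (2 * P.coinLen)) ^ n := by
    intro i
    rw [Finset.prod_mul_distrib, Finset.prod_const, Finset.card_univ, Fintype.card_fin]
  simp_rw [hrow]
  rw [Finset.prod_mul_distrib, Finset.prod_const, Finset.card_univ, Fintype.card_fin, ← pow_mul, ← pow_mul]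
  congr 1
  ring_nf

/-! ### From the real world to the ideal world -/

open scoped Classical

/-- The rounded input `X̃ = round_b X`. [folklore] -/
def roundedInput (b : ℕ) (X : Fin n → Fin n → ℂ) (i j : Fin n) : ℤ × ℤ := roundDyadic b (X i j)

/-- `X ↦ X̃` is measurable. [folklore] -/
theorem measurable_roundedInput (b : ℕ) : Measurable (roundedInput (n := n) b) := by
  refine measurable_pi_iff.2 fun i => measurable_pi_iff.2 fun j => ?_
  exact (measurable_roundDyadic b).comp ((measurable_pi_apply j).comp (measurable_pi_apply i))

/-- Every event of the rounded input is measurable. [folklore] -/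
theorem measurableSet_roundedInput (b : ℕ) (Q : (Fin n → Fin n → ℤ × ℤ) → Prop) :
    MeasurableSet {X : Fin n → Fin n → ℂ | Q (roundedInput b X)} := by
  classical
  have hm : Measurable fun X : Fin n → Fin n → ℂ => decide (Q (roundedInput b X)) :=
    (measurable_of_countable fun x => decide (Q x)).comp (measurable_roundedInput b)
  have hset : {X : Fin n → Fin n → ℂ | Q (roundedInput b X)} =
      (fun X => decide (Q (roundedInput b X))) ⁻¹' {true} := by
    ext X; simp
  rw [hset]
  exact hm (measurableSet_singleton true)

/-- The in-range rounded inputs: every coordinate has modulus `< T`. [folklore] -/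
def InRange (T : ℕ) (x : Fin n → Fin n → ℤ × ℤ) : Prop :=
  ∀ i j, (x i j).1.natAbs < T ∧ (x i j).2.natAbs < T

/-- The finite set of in-range rounded inputs. [folklore] -/
def rangeFinset (n T : ℕ) : Finset (Fin n → Fin n → ℤ × ℤ) :=
  Fintype.piFinset fun _ => Fintype.piFinset fun _ => (Ioo (-(T : ℤ)) T) ×ˢ (Ioo (-(T : ℤ)) T)

/-- Membership in the finite set is being in range. [folklore] -/
theorem mem_rangeFinset {T : ℕ} {x : Fin n → Fin n → ℤ × ℤ} : x ∈ rangeFinset n T ↔ InRange T x := by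
  simp only [rangeFinset, Fintype.mem_piFinset, mem_product, mem_Ioo, InRange]
  refine forall_congr' fun i => forall_congr' fun j => ?_
  omega

/-- **Domination of the in-range rounded laws**: `Pr[X̃ = x̃] ≤ F^{2n²} ∏ᵢⱼ law law` when
`gaussBox ≤ F · law` on the range. [folklore] -/
theorem real_roundEq_le_of_inRange {F : ℝ} (hF : 0 ≤ F)
    (hdom : ∀ j : ℤ, j.natAbs < P.T → gaussBox P.b j ≤ F * P.law j) {x : Fin n → Fin n → ℤ × ℤ}
    (hx : InRange P.T x) :
    (gaussianMatrixMeasure n).real {X | ∀ i j, roundDyadic P.b (X i j) = x i j} ≤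
      F ^ (2 * (n * n)) * ∏ i, ∏ j, (P.law (x i j).1 * P.law (x i j).2) := by
  rw [gaussianMatrixMeasure_real_roundEq]
  have hterm : ∀ i j, gaussBox P.b (x i j).1 * gaussBox P.b (x i j).2 ≤
      (F * F) * (P.law (x i j).1 * P.law (x i j).2) := fun i j => by
    have h1 := hdom _ (hx i j).1
    have h2 := hdom _ (hx i j).2
    calc gaussBox P.b (x i j).1 * gaussBox P.b (x i j).2 ≤ (F * P.law (x i j).1) * (F * P.law (x i j).2) :=
          mul_le_mul h1 h2 (gaussBox_nonneg _ _) (by have := P.law_nonneg (x i j).1; positivity)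
      _ = (F * F) * (P.law (x i j).1 * P.law (x i j).2) := by ring
  calc ∏ i, ∏ j, gaussBox P.b (x i j).1 * gaussBox P.b (x i j).2
      ≤ ∏ i, ∏ j, (F * F) * (P.law (x i j).1 * P.law (x i j).2) :=
        Finset.prod_le_prod (fun i _ => Finset.prod_nonneg fun j _ => mul_nonneg (gaussBox_nonneg _ _) (gaussBox_nonneg _ _))
          fun i _ => Finset.prod_le_prod (fun j _ => mul_nonneg (gaussBox_nonneg _ _) (gaussBox_nonneg _ _))
            fun j _ => hterm i j
    _ = F ^ (2 * (n * n)) * ∏ i, ∏ j, (P.law (x i j).1 * P.law (x i j).2) := by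
        simp_rw [Finset.prod_mul_distrib, Finset.prod_const, Finset.card_univ, Fintype.card_fin]
        rw [← pow_mul]; ring_nf

/-- The real probability of an event of `(X̃, r)`, split along the range. [folklore] -/
theorem real_roundEvent_le_sum (Q : (Fin n → Fin n → ℤ × ℤ) → Prop) [DecidablePred Q] :
    (gaussianMatrixMeasure n).real {X | Q (roundedInput P.b X)} ≤
      (gaussianMatrixMeasure n).real {X | ¬ InRange P.T (roundedInput P.b X)} +
        ∑ x ∈ (rangeFinset n P.T).filter Q,
          (gaussianMatrixMeasure n).real {X | ∀ i j, roundDyadic P.b (X i j) = x i j} := by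
  classical
  have hsub : {X : Fin n → Fin n → ℂ | Q (roundedInput P.b X)} ⊆
      {X | ¬ InRange P.T (roundedInput P.b X)} ∪
        ⋃ x ∈ (rangeFinset n P.T).filter Q, {X | ∀ i j, roundDyadic P.b (X i j) = x i j} := by
    intro X hX
    by_cases hr : InRange P.T (roundedInput P.b X)
    · refine Or.inr ?_
      simp only [Set.mem_iUnion, Set.mem_setOf_eq, mem_filter, exists_prop]
      exact ⟨roundedInput P.b X, ⟨mem_rangeFinset.2 hr, hX⟩, fun i j => rfl⟩
    · exact Or.inl hr
  calc (gaussianMatrixMeasure n).real {X | Q (roundedInput P.b X)}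
      ≤ (gaussianMatrixMeasure n).real ({X | ¬ InRange P.T (roundedInput P.b X)} ∪
          ⋃ x ∈ (rangeFinset n P.T).filter Q, {X | ∀ i j, roundDyadic P.b (X i j) = x i j}) :=
        measureReal_mono hsub
    _ ≤ (gaussianMatrixMeasure n).real {X | ¬ InRange P.T (roundedInput P.b X)} +
          (gaussianMatrixMeasure n).real (⋃ x ∈ (rangeFinset n P.T).filter Q,
            {X | ∀ i j, roundDyadic P.b (X i j) = x i j}) := measureReal_union_le _ _
    _ ≤ _ := add_le_add le_rfl (measureReal_biUnion_finset_le _ _)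

/-- Counting the coin segments fiberwise over a finite set of values. [folklore] -/
theorem sum_card_rowsOfCoins_eq_le (A : Finset (Fin n → Fin n → ℤ × ℤ)) (Q : (Fin n → Fin n → ℤ × ℤ) → Prop)
    [DecidablePred Q] :
    ∑ x ∈ A.filter Q, (univ.filter fun v : List.Vector Bool (n * (n * (2 * P.coinLen))) => rowsOfCoins P v = x).card ≤
      (univ.filter fun v : List.Vector Bool (n * (n * (2 * P.coinLen))) => Q (rowsOfCoins P v)).card := by
  classical
  set s : Finset (List.Vector Bool (n * (n * (2 * P.coinLen)))) :=
    univ.filter fun v => rowsOfCoins P v ∈ A.filter Q with hs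
  have hmaps : (s : Set (List.Vector Bool (n * (n * (2 * P.coinLen))))).MapsTo (fun v => rowsOfCoins P v) (A.filter Q) :=
    fun v hv => by simpa [hs] using hv
  have h := card_eq_sum_card_fiberwise hmaps
  have hfib : ∀ x ∈ A.filter Q, (s.filter fun v => rowsOfCoins P v = x) =
      univ.filter fun v : List.Vector Bool (n * (n * (2 * P.coinLen))) => rowsOfCoins P v = x := by
    intro x hx
    ext v
    simp only [hs, mem_filter, mem_univ, true_and]
    refine ⟨fun h => h.2, fun h => ⟨?_, h⟩⟩
    rw [h]; exact mem_filter.1 hx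
  have hle : s.card ≤ (univ.filter fun v : List.Vector Bool (n * (n * (2 * P.coinLen))) => Q (rowsOfCoins P v)).card := by
    refine card_le_card fun v hv => ?_
    simp only [hs, mem_filter, mem_univ, true_and] at hv ⊢
    exact hv.2
  calc ∑ x ∈ A.filter Q, (univ.filter fun v : List.Vector Bool (n * (n * (2 * P.coinLen))) => rowsOfCoins P v = x).card
      = ∑ x ∈ A.filter Q, (s.filter fun v => rowsOfCoins P v = x).card :=
        Finset.sum_congr rfl fun x hx => by rw [hfib x hx]
    _ = s.card := h.symm
    _ ≤ _ := hle

/-- **From the real world to the ideal world.** For every event `E(x̃, r)` of the rounded input and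
the coin string `r ∈ {0,1}^L`: if the rounded-Gaussian box masses are dominated on the range,
`gaussBox b j ≤ F · law j` for `|j| < T`, then
`∑_r Pr_X[E(X̃, r)] ≤ 2^L · Pr_X[X̃ out of range] + F^{2n²} 2^{-Lₓ} · #{(rₓ, r) | E(rows(rₓ), r)}`,
where `rows(rₓ)` are the planted rows of the ideal world read off a coin segment `rₓ ∈ {0,1}^{Lₓ}`.
[cite: AaronsonArkhipovToC2013, §5.2 (proof of Thm. 1.3, p. 195)] -/
theorem sum_real_roundEvent_le {L : ℕ} (E : (Fin n → Fin n → ℤ × ℤ) → List Bool → Prop)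
    [∀ x r, Decidable (E x r)] {F : ℝ} (hF : 0 ≤ F)
    (hdom : ∀ j : ℤ, j.natAbs < P.T → gaussBox P.b j ≤ F * P.law j) :
    (∑ r : List.Vector Bool L, (gaussianMatrixMeasure n).real {X | E (roundedInput P.b X) r.toList}) ≤
      2 ^ L * (gaussianMatrixMeasure n).real {X | ¬ InRange P.T (roundedInput P.b X)} +
        F ^ (2 * (n * n)) / 2 ^ (n * (n * (2 * P.coinLen))) *
          ((univ.filter fun q : List.Vector Bool (n * (n * (2 * P.coinLen))) × List.Vector Bool L =>
              E (rowsOfCoins P q.1) q.2.toList).card : ℝ) := by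
  classical
  -- per coin string
  have hper : ∀ r : List.Vector Bool L,
      (gaussianMatrixMeasure n).real {X | E (roundedInput P.b X) r.toList} ≤
        (gaussianMatrixMeasure n).real {X | ¬ InRange P.T (roundedInput P.b X)} +
          F ^ (2 * (n * n)) / 2 ^ (n * (n * (2 * P.coinLen))) *
            ((univ.filter fun v : List.Vector Bool (n * (n * (2 * P.coinLen))) => E (rowsOfCoins P v) r.toList).card : ℝ) := by
    intro r
    refine (real_roundEvent_le_sum P (fun x => E x r.toList)).trans (add_le_add le_rfl ?_)
    calc ∑ x ∈ (rangeFinset n P.T).filter (fun x => E x r.toList),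
          (gaussianMatrixMeasure n).real {X | ∀ i j, roundDyadic P.b (X i j) = x i j}
        ≤ ∑ x ∈ (rangeFinset n P.T).filter (fun x => E x r.toList),
            F ^ (2 * (n * n)) * ∏ i, ∏ j, (P.law (x i j).1 * P.law (x i j).2) :=
          Finset.sum_le_sum fun x hx => real_roundEq_le_of_inRange P hF hdom
            (mem_rangeFinset.1 (mem_filter.1 hx).1)
      _ = F ^ (2 * (n * n)) / 2 ^ (n * (n * (2 * P.coinLen))) * ∑ x ∈ (rangeFinset n P.T).filter (fun x => E x r.toList),
            ((univ.filter fun v : List.Vector Bool (n * (n * (2 * P.coinLen))) => rowsOfCoins P v = x).card : ℝ) := by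
          rw [Finset.mul_sum]
          refine Finset.sum_congr rfl fun x _ => ?_
          rw [card_rowsOfCoins_eq]
          field_simp
      _ ≤ F ^ (2 * (n * n)) / 2 ^ (n * (n * (2 * P.coinLen))) *
            ((univ.filter fun v : List.Vector Bool (n * (n * (2 * P.coinLen))) => E (rowsOfCoins P v) r.toList).card : ℝ) := by
          refine mul_le_mul_of_nonneg_left ?_ (by positivity)
          exact_mod_cast sum_card_rowsOfCoins_eq_le P (rangeFinset n P.T) (fun x => E x r.toList)
  -- sum over the coin strings
  calc ∑ r : List.Vector Bool L, (gaussianMatrixMeasure n).real {X | E (roundedInput P.b X) r.toList}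
      ≤ ∑ r : List.Vector Bool L, ((gaussianMatrixMeasure n).real {X | ¬ InRange P.T (roundedInput P.b X)} +
          F ^ (2 * (n * n)) / 2 ^ (n * (n * (2 * P.coinLen))) *
            ((univ.filter fun v : List.Vector Bool (n * (n * (2 * P.coinLen))) => E (rowsOfCoins P v) r.toList).card : ℝ)) :=
        Finset.sum_le_sum fun r _ => hper r
    _ = 2 ^ L * (gaussianMatrixMeasure n).real {X | ¬ InRange P.T (roundedInput P.b X)} +
          F ^ (2 * (n * n)) / 2 ^ (n * (n * (2 * P.coinLen))) *
            ((univ.filter fun q : List.Vector Bool (n * (n * (2 * P.coinLen))) × List.Vector Bool L => E (rowsOfCoins P q.1) q.2.toList).card : ℝ) := by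
        have hcount : ((univ.filter fun q : List.Vector Bool (n * (n * (2 * P.coinLen))) × List.Vector Bool L =>
              E (rowsOfCoins P q.1) q.2.toList).card : ℝ) =
            ∑ r : List.Vector Bool L, ((univ.filter fun v : List.Vector Bool (n * (n * (2 * P.coinLen))) =>
              E (rowsOfCoins P v) r.toList).card : ℝ) := by
          rw [Finset.card_filter, Fintype.sum_prod_type, Finset.sum_comm]
          push_cast
          refine Finset.sum_congr rfl fun r _ => ?_
          rw [Finset.card_filter]
          push_cast
          rfl
        rw [Finset.sum_add_distrib, Finset.sum_const, Finset.card_univ, card_vector, Fintype.card_bool, nsmul_eq_mul,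
          ← Finset.mul_sum, hcount]
        push_cast
        ring

end Literature.Computability.QuantumComplexity
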